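import Literature.NumberTheory.PAdicHodge.PadicBaseField
import Literature.NumberTheory.PAdicHodge.AxSenTateRelative
import Mathlib.NumberTheory.Cyclotomic.CyclotomicCharacter
import HarnessLib

/-!
# The Galois group of `F̄` over `ℚ_p` acting on `F̄` and on `ℂ_F`

Continuation of `PadicBaseField`. Let `F` be a non-archimedean local field of characteristic `0`
and residue characteristic `p`, `K₀ = PadicBase F p hp ≅ ℚ_p` its base field (normed by `F`),
`F̄ = NormedAlgClosure F` (an algebraic closure of `K₀` as well) and `ℂ_F = CompletedAlgClosure F`.
Tate–Sen theory (Tate 1967, §3) uses the Galois group of `F̄` over the BASE `ℚ_p`,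

  `G₀ := Gal(F̄/K₀) = F̄ ≃ₐ[K₀] F̄`  (`BaseGaloisGroup hp`),

which contains `Γ_F = Gal(F̄/F)` as the subgroup fixing `F` (`toBase`, `exists_toBase_eq`). This
file proves that `G₀` acts on `F̄` **by isometries** (`BaseGaloisGroup.norm_smul`) — by the
uniqueness of the absolute value of `F̄` extending that of the COMPLETE field `K₀` (Mathlib
`spectralNorm_unique_field_norm_ext`; Neukirch II (4.8), applied over `ℚ_p` rather than `F`) —
and extends the action to `ℂ_F` by continuity exactly as for `Γ_F` in `CompletedAlgClosure`
(`CompletedAlgClosure.instBaseAction`, `base_smul_coe`, `norm_base_smul`), compatibly with the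
`Γ_F`-action (`toBase_smul`, `toBase_smul_completion`). It also records the supply of elements of
`G₀`: conjugate elements over any intermediate field `K₀ ⊆ L ⊆ F̄` are `G₀`-conjugate by an
element fixing `L` (`exists_smul_eq_of_mem_aroots_base`), and the cyclotomic character of `G₀`
(`baseCyclotomicCharacter`, Mathlib's `cyclotomicCharacter` of `F̄`) with its defining property
and its compatibility with the tree's `GaloisRep.cyclotomicCharacter F p` on `Γ_F`.

## References

* J. Tate, *p-divisible groups* (1967), §3.1–§3.3 (the groups `G = Gal(K̄/K)`, `H`, and `C`).
  [Tate1967]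
* J. Neukirch, *Algebraic Number Theory*, Ch. II (4.8) (uniqueness of the extended absolute value).
  [NeukirchANT1999]
* J.-P. Serre, *Abelian ℓ-adic representations* (1968), Ch. I §1.2 (cyclotomic character).
  [SerreAbelianLadic1968]
-/

noncomputable section

open ValuativeRel Field UniformSpace Polynomial

namespace Literature.NumberTheory.PAdicHodge

open Literature.NumberTheory.GaloisRepresentations
open Literature.NumberTheory.GaloisRepresentations.IsNonarchimedeanLocalField

variable {F : Type} [Field F] [ValuativeRel F] [TopologicalSpace F] [IsNonarchimedeanLocalField F]
  [CharZero F] {p : ℕ} [Fact p.Prime] (hp : valuation F p < 1)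

/-- **The Galois group of `F̄` over the base field `ℚ_p`**: `G₀ = F̄ ≃ₐ[K₀] F̄`,
`K₀ = PadicBase F p hp`. (An `abbrev`: Mathlib's group structure and its action
`AlgEquiv.applyMulSemiringAction` on `F̄` apply.) [cite: Tate1967, §3.1] -/
abbrev BaseGaloisGroup : Type := NormedAlgClosure F ≃ₐ[PadicBase F p hp] NormedAlgClosure F

namespace BaseGaloisGroup

/-- `g • x = g x`. [folklore] -/
theorem smul_def (g : BaseGaloisGroup hp) (x : NormedAlgClosure F) : g • x = g x := rfl

/-- `G₀` fixes `K₀ ⊆ F̄`. [folklore] -/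
theorem smul_algebraMap (g : BaseGaloisGroup hp) (c : PadicBase F p hp) :
    g • algebraMap (PadicBase F p hp) (NormedAlgClosure F) c =
      algebraMap (PadicBase F p hp) (NormedAlgClosure F) c :=
  g.commutes c

/-! ### `G₀` acts on `F̄` by isometries -/

/-- The absolute value `x ↦ ‖g x‖` of `F̄`, for `g ∈ G₀`. Auxiliary. [folklore] -/
def absValueComp (g : BaseGaloisGroup hp) : AbsoluteValue (NormedAlgClosure F) ℝ where
  toFun x := ‖g x‖
  map_mul' x y := by simp only [map_mul, norm_mul]
  nonneg' x := norm_nonneg _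
  eq_zero' x := by simp only [norm_eq_zero, EmbeddingLike.map_eq_zero_iff]
  add_le' x y := by simp only [map_add]; exact norm_add_le _ _

/-- **`G₀` acts on `F̄` by isometries**: `‖g • x‖ = ‖x‖`. Both `‖·‖` and `‖g ·‖` are absolute
values on the algebraic extension `F̄` of the complete field `K₀` extending `‖·‖_{K₀}`, hence both
are the spectral norm over `K₀` (Mathlib `spectralNorm_unique_field_norm_ext`).
[cite: NeukirchANT1999, Ch. II (4.8)] -/
theorem norm_smul (g : BaseGaloisGroup hp) (x : NormedAlgClosure F) : ‖g • x‖ = ‖x‖ := by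
  have h1 : ∀ c : PadicBase F p hp,
      absValueComp hp g (algebraMap (PadicBase F p hp) (NormedAlgClosure F) c) = ‖c‖ := by
    intro c
    change ‖g (algebraMap (PadicBase F p hp) (NormedAlgClosure F) c)‖ = ‖c‖
    rw [g.commutes c, PadicBase.norm_algebraMap_closure]
  have h2 : ∀ c : PadicBase F p hp,
      absValueComp hp 1 (algebraMap (PadicBase F p hp) (NormedAlgClosure F) c) = ‖c‖ := by
    intro c
    change ‖(1 : BaseGaloisGroup hp) (algebraMap (PadicBase F p hp) (NormedAlgClosure F) c)‖ = ‖c‖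
    rw [AlgEquiv.one_apply, PadicBase.norm_algebraMap_closure]
  have e1 : ‖g x‖ = spectralNorm (PadicBase F p hp) (NormedAlgClosure F) x :=
    spectralNorm_unique_field_norm_ext h1 x
  have e2 : ‖(1 : BaseGaloisGroup hp) x‖ = spectralNorm (PadicBase F p hp) (NormedAlgClosure F) x :=
    spectralNorm_unique_field_norm_ext h2 x
  rw [AlgEquiv.one_apply] at e2
  rw [smul_def, e1, ← e2]

/-- Each `g ∈ G₀` is an isometry of `F̄`. [cite: NeukirchANT1999, Ch. II (4.8)] -/
theorem isometry_smul (g : BaseGaloisGroup hp) :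
    Isometry (fun x : NormedAlgClosure F => g • x) :=
  AddMonoidHomClass.isometry_of_norm (MulSemiringAction.toRingHom _ (NormedAlgClosure F) g)
    (fun x => norm_smul hp g x)

/-- Each `g ∈ G₀` is uniformly continuous on `F̄`. [folklore] -/
theorem uniformContinuous_smul (g : BaseGaloisGroup hp) :
    UniformContinuous (fun x : NormedAlgClosure F => g • x) :=
  (isometry_smul hp g).uniformContinuous

/-- The `G₀`-action on `F̄` is by uniformly continuous maps (this makes Mathlib's action of `G₀` on
the completion `ℂ_F` available). [folklore] -/
instance instUniformContinuousConstSMul :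
    UniformContinuousConstSMul (BaseGaloisGroup hp) (NormedAlgClosure F) :=
  ⟨uniformContinuous_smul hp⟩

/-! ### `Γ_F ≤ G₀` -/

/-- **`Γ_F → G₀`**: an `F`-automorphism of `F̄` is a `K₀`-automorphism (restriction of scalars along
`K₀ → F`). [cite: Tate1967, §3.1] -/
def toBase : absoluteGaloisGroup F →* BaseGaloisGroup hp where
  toFun σ := (MulSemiringAction.toAlgEquiv F (NormedAlgClosure F) σ).restrictScalars (PadicBase F p hp)
  map_one' := by ext x; simp
  map_mul' σ τ := by ext x; simp [mul_smul]

/-- `toBase σ` acts on `F̄` as `σ`. [folklore] -/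
@[simp] theorem toBase_smul (σ : absoluteGaloisGroup F) (x : NormedAlgClosure F) :
    toBase hp σ • x = σ • x := rfl

/-- `toBase` is injective. [folklore] -/
theorem toBase_injective : Function.Injective (toBase hp) := by
  intro σ τ h
  apply (absoluteGaloisGroup.toAlgEquiv F).injective
  refine AlgEquiv.ext fun x => ?_
  exact congrArg (fun g : BaseGaloisGroup hp =>
    NormedAlgClosure.toAlgClosure (g • NormedAlgClosure.toAlgClosure.symm x)) h

/-- **The image of `Γ_F` in `G₀` is the subgroup fixing `F`**: a `K₀`-automorphism of `F̄` fixing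
`F` pointwise is `toBase σ` for a (unique) `σ ∈ Γ_F`. [cite: Tate1967, §3.1] -/
theorem exists_toBase_eq (g : BaseGaloisGroup hp)
    (hg : ∀ c : F, g • algebraMap F (NormedAlgClosure F) c = algebraMap F (NormedAlgClosure F) c) :
    ∃ σ : absoluteGaloisGroup F, toBase hp σ = g := by
  let s : NormedAlgClosure F ≃ₐ[F] NormedAlgClosure F :=
    { (g : NormedAlgClosure F ≃+* NormedAlgClosure F) with
      commutes' := fun c => hg c }
  obtain ⟨σ, hσ⟩ := NormedAlgClosure.exists_smul_eq_of_algEquiv (F := F) s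
  refine ⟨σ, AlgEquiv.ext fun x => ?_⟩
  change toBase hp σ • x = g x
  rw [toBase_smul, hσ x]
  rfl

/-- `toBase σ` fixes `F`. [folklore] -/
theorem toBase_smul_algebraMap (σ : absoluteGaloisGroup F) (c : F) :
    toBase hp σ • algebraMap F (NormedAlgClosure F) c = algebraMap F (NormedAlgClosure F) c := by
  rw [toBase_smul, NormedAlgClosure.smul_algebraMap]

/-! ### Supply of elements of `G₀`: conjugates over intermediate fields -/

/-- `F̄` is an algebraic closure of every intermediate field `K₀ ⊆ L ⊆ F̄`; in particular `F̄/L`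
is normal. [folklore] -/
instance instIsAlgClosureIntermediateField
    (L : IntermediateField (PadicBase F p hp) (NormedAlgClosure F)) :
    IsAlgClosure L (NormedAlgClosure F) where
  isAlgClosed := inferInstance
  isAlgebraic := Algebra.IsAlgebraic.tower_top (K := PadicBase F p hp) L

/-- Every `L`-algebra automorphism of `F̄` (`K₀ ⊆ L ⊆ F̄`) is the action of an element of `G₀`
fixing `L` pointwise. [folklore] -/
theorem exists_smul_eq_of_algEquiv_base
    (L : IntermediateField (PadicBase F p hp) (NormedAlgClosure F))
    (s : NormedAlgClosure F ≃ₐ[L] NormedAlgClosure F) :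
    ∃ g : BaseGaloisGroup hp, (∀ y ∈ L, g • y = y) ∧ ∀ x : NormedAlgClosure F, g • x = s x :=
  ⟨s.restrictScalars (PadicBase F p hp), fun y hy => s.commutes ⟨y, hy⟩, fun _ => rfl⟩

/-- **Conjugates are `G₀`-conjugate**: every root in `F̄` of the minimal polynomial of `α` over an
intermediate field `K₀ ⊆ L ⊆ F̄` is `g • α` for some `g ∈ G₀` fixing `L` pointwise (`F̄/L` is
normal). [folklore] -/
theorem exists_smul_eq_of_mem_aroots_base
    (L : IntermediateField (PadicBase F p hp) (NormedAlgClosure F))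
    (α r : NormedAlgClosure F) (hr : r ∈ (minpoly L α).aroots (NormedAlgClosure F)) :
    ∃ g : BaseGaloisGroup hp, (∀ y ∈ L, g • y = y) ∧ r = g • α := by
  have hint : IsIntegral L α := Algebra.IsIntegral.isIntegral α
  have hconj : IsConjRoot L α r := (isConjRoot_iff_mem_minpoly_aroots hint).mpr hr
  obtain ⟨s, hs⟩ := hconj.exists_algEquiv
  obtain ⟨g, hgL, hg⟩ := exists_smul_eq_of_algEquiv_base hp L s.symm
  refine ⟨g, hgL, ?_⟩
  rw [hg, ← hs, AlgEquiv.symm_apply_apply]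

/-- Conjugates over `K₀` itself are `G₀`-conjugate. [folklore] -/
theorem exists_smul_eq_of_mem_aroots (α r : NormedAlgClosure F)
    (hr : r ∈ (minpoly (PadicBase F p hp) α).aroots (NormedAlgClosure F)) :
    ∃ g : BaseGaloisGroup hp, r = g • α := by
  have hint : IsIntegral (PadicBase F p hp) α := Algebra.IsIntegral.isIntegral α
  have hconj : IsConjRoot (PadicBase F p hp) α r := (isConjRoot_iff_mem_minpoly_aroots hint).mpr hr
  obtain ⟨s, hs⟩ := hconj.exists_algEquiv
  exact ⟨s.symm, by rw [smul_def, ← hs, AlgEquiv.symm_apply_apply]⟩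

/-- All `G₀`-conjugates of `α` have the same absolute value. [folklore] -/
theorem norm_eq_of_mem_aroots (α r : NormedAlgClosure F)
    (hr : r ∈ (minpoly (PadicBase F p hp) α).aroots (NormedAlgClosure F)) : ‖r‖ = ‖α‖ := by
  obtain ⟨g, rfl⟩ := exists_smul_eq_of_mem_aroots hp α r hr
  exact norm_smul hp g α

/-! ### The cyclotomic character of `G₀` -/

/-- **The `p`-adic cyclotomic character of `G₀`**: Mathlib's `cyclotomicCharacter` of the domain
`F̄` composed with the action `G₀ →* (F̄ ≃+* F̄)`. [cite: SerreAbelianLadic1968, Ch. I §1.2] -/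
def baseCyclotomicCharacter : BaseGaloisGroup hp →* ℤ_[p]ˣ :=
  (cyclotomicCharacter (NormedAlgClosure F) p).comp
    (MulSemiringAction.toRingAut (BaseGaloisGroup hp) (NormedAlgClosure F))

/-- `F̄` has enough `p`-power roots of unity (it is algebraically closed of characteristic `0`).
[folklore] -/
instance instHasEnoughRootsOfUnity (k : ℕ) : HasEnoughRootsOfUnity (NormedAlgClosure F) (p ^ k) :=
  haveI : NeZero ((p ^ k : ℕ) : NormedAlgClosure F) :=
    ⟨by rw [Nat.cast_pow]; exact pow_ne_zero k (Nat.cast_ne_zero.mpr (Fact.out : p.Prime).ne_zero)⟩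
  inferInstance

/-- Defining property of the cyclotomic character of `G₀`: `g • ζ = ζ ^ (χ(g) mod p^k)` for
`ζ^{p^k} = 1`. [cite: SerreAbelianLadic1968, Ch. I §1.2] -/
theorem baseCyclotomicCharacter_spec (g : BaseGaloisGroup hp) {k : ℕ} (ζ : NormedAlgClosure F)
    (hζ : ζ ^ p ^ k = 1) :
    g • ζ = ζ ^ ((PadicInt.toZModPow k (baseCyclotomicCharacter hp g : ℤ_[p])).val) :=
  cyclotomicCharacter.spec p
    (MulSemiringAction.toRingAut (BaseGaloisGroup hp) (NormedAlgClosure F) g) ζ hζ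

/-- **Compatibility with the cyclotomic character of `Γ_F`**: `χ(toBase σ) = χ_F(σ)` (the tree's
`GaloisRep.cyclotomicCharacter F p`) — both are characterised by the action on the `p`-power
roots of unity of `F̄`. [cite: SerreAbelianLadic1968, Ch. I §1.2] -/
theorem baseCyclotomicCharacter_toBase (σ : absoluteGaloisGroup F) :
    baseCyclotomicCharacter hp (toBase hp σ) = GaloisRep.cyclotomicCharacter F p σ := by
  haveI : NeZero (p : F) := ⟨Nat.cast_ne_zero.mpr (Fact.out : p.Prime).ne_zero⟩
  refine Units.ext (PadicInt.ext_of_toZModPow.mp fun n => ?_)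
  rw [baseCyclotomicCharacter, MonoidHom.comp_apply, cyclotomicCharacter.toZModPow]
  symm
  refine modularCyclotomicCharacter.unique (NormedAlgClosure F) _ _ (fun t ht => ?_)
  have ht' : ((t : (NormedAlgClosure F)ˣ) : NormedAlgClosure F) ^ p ^ n = 1 := by
    have := congrArg Units.val ((mem_rootsOfUnity _ t).mp ht)
    simpa using this
  -- `toBase σ` acts as `σ`, whose action on `p`-power roots of unity is `GaloisRep.cyclotomicCharacter_spec`
  exact GaloisRep.cyclotomicCharacter_spec F p σ
    (NormedAlgClosure.toAlgClosure ((t : (NormedAlgClosure F)ˣ) : NormedAlgClosure F)) ht'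

end BaseGaloisGroup

/-! ### The action of `G₀` on `ℂ_F` -/

namespace CompletedAlgClosure

/-- Unfolding of Mathlib's action of `G₀` on the completion: `g • x = Completion.map (g • ·) x`.
[cite: Tate1967, §3.1] -/
theorem base_smul_eq_map (g : BaseGaloisGroup hp) (x : CompletedAlgClosure F) :
    g • x = Completion.map (fun y : NormedAlgClosure F => g • y) x := rfl

/-- **The action of `G₀` on `ℂ_F` extends its action on `F̄`**: `g • ↑x = ↑(g • x)`.
[cite: Tate1967, §3.1] -/
theorem base_smul_coe (g : BaseGaloisGroup hp) (x : NormedAlgClosure F) :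
    g • (x : CompletedAlgClosure F) = ((g • x : NormedAlgClosure F) : CompletedAlgClosure F) :=
  (Completion.coe_smul g x).symm

/-- Each `g ∈ G₀` acts continuously on `ℂ_F`. [folklore] -/
theorem continuous_base_smul (g : BaseGaloisGroup hp) :
    Continuous (fun x : CompletedAlgClosure F => g • x) :=
  continuous_const_smul g

/-- **The continuous action of `G₀` on `ℂ_F` by ring automorphisms** (multiplicativity by density
from `F̄`, as for `Γ_F`). [cite: Tate1967, §3.1] -/
instance instBaseAction : MulSemiringAction (BaseGaloisGroup hp) (CompletedAlgClosure F) where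
  __ := (inferInstance : DistribMulAction (BaseGaloisGroup hp) (CompletedAlgClosure F))
  smul_one g := by
    rw [← Completion.coe_one, base_smul_coe, smul_one]
  smul_mul g x y := by
    refine Completion.induction_on₂ x y
      (isClosed_eq ((continuous_base_smul hp g).comp continuous_mul)
        (((continuous_base_smul hp g).comp continuous_fst).mul
          ((continuous_base_smul hp g).comp continuous_snd))) ?_
    intro a b
    rw [← Completion.coe_mul, base_smul_coe, base_smul_coe, base_smul_coe, ← Completion.coe_mul,
      smul_mul']

/-- **`G₀` acts on `ℂ_F` by isometries.** [cite: Tate1967, §3.1] -/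
theorem norm_base_smul (g : BaseGaloisGroup hp) (x : CompletedAlgClosure F) : ‖g • x‖ = ‖x‖ := by
  refine Completion.induction_on x
    (isClosed_eq (continuous_norm.comp (continuous_base_smul hp g)) continuous_norm) ?_
  intro a
  rw [base_smul_coe, Completion.norm_coe, Completion.norm_coe, BaseGaloisGroup.norm_smul]

/-- Each `g ∈ G₀` is an isometry of `ℂ_F`. [folklore] -/
theorem isometry_base_smul (g : BaseGaloisGroup hp) :
    Isometry (fun x : CompletedAlgClosure F => g • x) :=
  AddMonoidHomClass.isometry_of_norm
    (MulSemiringAction.toRingHom _ (CompletedAlgClosure F) g) (norm_base_smul hp g)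

/-- **Compatibility of the two actions on `ℂ_F`**: `toBase σ • x = σ • x`. [folklore] -/
@[simp] theorem toBase_smul_completion (σ : absoluteGaloisGroup F) (x : CompletedAlgClosure F) :
    BaseGaloisGroup.toBase hp σ • x = σ • x := by
  refine Completion.induction_on x
    (isClosed_eq (continuous_base_smul hp _) (continuous_constSMul σ)) ?_
  intro a
  rw [base_smul_coe, smul_coe, BaseGaloisGroup.toBase_smul]

/-- `G₀` fixes `K₀ ⊆ ℂ_F`. [folklore] -/
theorem base_smul_algebraMap (g : BaseGaloisGroup hp) (c : PadicBase F p hp) :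
    g • (algebraMap F (CompletedAlgClosure F) (algebraMap (PadicBase F p hp) F c)) =
      algebraMap F (CompletedAlgClosure F) (algebraMap (PadicBase F p hp) F c) := by
  rw [algebraMap_eq_coe, base_smul_coe]
  congr 1
  exact BaseGaloisGroup.smul_algebraMap hp g c

/-- `toBase σ` fixes `F ⊆ ℂ_F`. [folklore] -/
theorem toBase_smul_algebraMap_completion (σ : absoluteGaloisGroup F) (c : F) :
    BaseGaloisGroup.toBase hp σ • algebraMap F (CompletedAlgClosure F) c =
      algebraMap F (CompletedAlgClosure F) c := by
  rw [toBase_smul_completion, smul_algebraMap]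

end CompletedAlgClosure

end Literature.NumberTheory.PAdicHodge

end
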